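import Summits.Ventures.PercRepro.ProfilePointedCircuitClassesSixGirth
import Summits.Ventures.PercRepro.ProfilePointedCircuitClassesTwelveQuadE

/-!
# PercRepro — THE q = 7 ROW AT `n = 14` WHEN EVERY DELETION SATISFIES THE SECOND QUAD HYPOTHESIS
(p5, gen 43; `proofs/P5-GM1.md` §65(n))

§64 ADDENDUM 1 pinned the row `(14, 8)` of q = 7 to the twelve-point statement on the minors `N ／ x ∖ w`
(`thresholdIneq_seven_top_of_fourteen_of_inout`, modulo `InOutBottomTwelve`).  With the minor-quantified chain of
ProfilePointedCircuitClassesSixGirth every regime of the twelve-point statement that can be read off the minors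
lifts to the row.  HERE the second quad regime (ProfilePointedCircuitClassesTwelveQuadE) is lifted: the minor
`N ／ x ∖ w` (`x ≠ w` in `E`, `x` a non-loop; `12` points, rank `7`) satisfies the quad2 hypothesis as soon as the
DELETION `N ∖ w` does in the following sense (`Quad2Del`): for every `w ∈ E` and every `4`-set `D ⊆ E − w` with
`ρ((E − w) ∖ D) = 6`, `D` contains a `3`-set `P` with `ρ((E − w) ∖ P) = 6` or a pair `{a, a'}` with
`ρ((E − w) ∖ {a, a'}) = 7` and `ρ((E − w) ∖ (D ∖ {a, a'})) = 8` — because `ρ_{N ／ x ∖ w}(Y) = ρ_N(Y + x) − 1`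
turns the minor's conditions `ρ°(E° ∖ D) = 5`, `= 5`, `= 6`, `= 7` into these (`quad2_minor`), and the per-pair
inequality on the minors is the theorem `thruCount_five_le_thruCount_six_of_card_eq_twelve` of §64.  HENCE
**`thresholdIneq_seven_top_of_fourteen_of_quad2del : ThresholdIneq N 7 7`** and `biIndep_step_six_of_fourteen_of_quad2del`
(`8·P_6 ≤ 7·P_7`) on every matroid with `14` points and rank `8` satisfying `Quad2Del`.
-/

open scoped Matroid

namespace PercRepro.Cogirth

open Finset ThmH Skew Shadow Profile

variable {α : Type} [DecidableEq α] {N : Matroid α} [N.Finite]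

section FourteenQuad2

/-- The second quad hypothesis on every deletion `N ∖ w`, read in `N`: for `w ∈ E` and a `4`-set `D ⊆ E − w` with
`ρ((E − w) ∖ D) = 6`, `D` contains a `3`-set `P` with `ρ((E − w) ∖ P) = 6` or a pair `{a, a'}` with
`ρ((E − w) ∖ {a, a'}) = 7` and `ρ((E − w) ∖ (D ∖ {a, a'})) = 8`. -/
def Quad2Del (N : Matroid α) [N.Finite] : Prop :=
  ∀ w ∈ gr N, ∀ D ⊆ (gr N).erase w, D.card = 4 → rk N ((gr N).erase w \ D) = 6 →
    (∃ P ⊆ D, P.card = 3 ∧ rk N ((gr N).erase w \ P) = 6) ∨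
    (∃ a ∈ D, ∃ a' ∈ D, a ≠ a' ∧ rk N ((gr N).erase w \ {a, a'}) = 7 ∧
      rk N ((gr N).erase w \ (D \ {a, a'})) = 8)

/-- The rank of a subset of the minor `N ／ x ∖ w`: `ρ°(Y) = ρ_N(Y + x) − 1` for `Y ⊆ E − x − w`, `x` a non-loop. -/
theorem rk_minor_add_one {x w : α} (hx1 : rk N {x} = 1) {Y : Finset α}
    (hY : Y ⊆ gr ((N ／ ({x} : Set α)) ＼ ({w} : Set α))) :
    rk ((N ／ ({x} : Set α)) ＼ ({w} : Set α)) Y + 1 = rk N (insert x Y) := by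
  have hgr : gr ((N ／ ({x} : Set α)) ＼ ({w} : Set α)) = ((gr N).erase x).erase w := by
    rw [gr_delete', gr_contract']
  rw [hgr] at hY
  have hYsub : Y ⊆ (gr N).erase x := hY.trans (erase_subset _ _)
  have h1 : rk ((N ／ ({x} : Set α)) ＼ ({w} : Set α)) Y = rk (N ／ ({x} : Set α)) Y := by
    apply rk_delete (M := N ／ ({x} : Set α))
    rw [gr_contract']
    exact hY
  have hind : N.Indep ({x} : Set α) := by
    have h := indep_of_rk_eq_card' (M := N) (X := {x}) (by rw [hx1, card_singleton])
    simpa using h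
  rw [h1]
  exact rk_contract_add_one (M := N) hind hYsub

/-- The complement in the minor's ground set, carried to `N`: `(E° ∖ Y) + x = (E − w) ∖ Y` for `Y ⊆ E°`. -/
theorem insert_sdiff_minor_eq {x w : α} (hxg : x ∈ gr N) (hxw : x ≠ w) {Y : Finset α}
    (hY : Y ⊆ ((gr N).erase x).erase w) :
    insert x (((gr N).erase x).erase w \ Y) = (gr N).erase w \ Y := by
  have hxY : x ∉ Y := fun h => (mem_erase.1 (mem_of_mem_erase (hY h))).1 rfl
  ext y
  simp only [mem_insert, mem_sdiff, mem_erase]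
  constructor
  · rintro (rfl | ⟨⟨hyw, _, hyg⟩, hyY⟩)
    · exact ⟨⟨hxw, hxg⟩, hxY⟩
    · exact ⟨⟨hyw, hyg⟩, hyY⟩
  · rintro ⟨⟨hyw, hyg⟩, hyY⟩
    by_cases hyx : y = x
    · exact Or.inl hyx
    · exact Or.inr ⟨⟨hyw, hyx, hyg⟩, hyY⟩

/-- **THE QUAD2 HYPOTHESIS PASSES TO THE MINORS**: under `Quad2Del`, every minor `N ／ x ∖ w` (`x ≠ w` in `E`, `x`
a non-loop) satisfies the hypothesis of `inCount_five_le_outCount_six_of_twelve_of_quad2`. -/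
theorem quad2_minor (hq : Quad2Del N) {x w : α} (hxg : x ∈ gr N) (hwg : w ∈ gr N) (hxw : x ≠ w)
    (hx1 : rk N {x} = 1) :
    ∀ D ⊆ gr ((N ／ ({x} : Set α)) ＼ ({w} : Set α)), D.card = 4 →
      rk ((N ／ ({x} : Set α)) ＼ ({w} : Set α)) (gr ((N ／ ({x} : Set α)) ＼ ({w} : Set α)) \ D) = 5 →
      (∃ P ⊆ D, P.card = 3 ∧ rk ((N ／ ({x} : Set α)) ＼ ({w} : Set α))
          (gr ((N ／ ({x} : Set α)) ＼ ({w} : Set α)) \ P) = 5) ∨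
      (∃ a ∈ D, ∃ a' ∈ D, a ≠ a' ∧
        rk ((N ／ ({x} : Set α)) ＼ ({w} : Set α)) (gr ((N ／ ({x} : Set α)) ＼ ({w} : Set α)) \ {a, a'}) = 6 ∧
        rk ((N ／ ({x} : Set α)) ＼ ({w} : Set α))
          (gr ((N ／ ({x} : Set α)) ＼ ({w} : Set α)) \ (D \ {a, a'})) = 7) := by
  intro D hD hD4 hDr
  have hgr : gr ((N ／ ({x} : Set α)) ＼ ({w} : Set α)) = ((gr N).erase x).erase w := by
    rw [gr_delete', gr_contract']
  -- the translation of a complement rank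
  have tr : ∀ Y ⊆ ((gr N).erase x).erase w,
      rk ((N ／ ({x} : Set α)) ＼ ({w} : Set α)) (gr ((N ／ ({x} : Set α)) ＼ ({w} : Set α)) \ Y) + 1 =
        rk N ((gr N).erase w \ Y) := by
    intro Y hY
    rw [← insert_sdiff_minor_eq hxg hxw hY, ← rk_minor_add_one hx1 (by rw [hgr]; exact sdiff_subset), hgr]
  rw [hgr] at hD
  have hDw : D ⊆ (gr N).erase w := hD.trans (erase_subset_erase w (erase_subset x _))
  have h1 := tr D hD
  rcases hq w hwg D hDw hD4 (by omega) with ⟨P, hPD, hP3, hPr⟩ | ⟨a, ha, a', ha', haa', hpair, hrest⟩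
  · left
    refine ⟨P, hPD, hP3, ?_⟩
    have h2 := tr P (hPD.trans hD)
    omega
  · right
    refine ⟨a, ha, a', ha', haa', ?_, ?_⟩
    · have h2 := tr {a, a'} (insert_subset (hD ha) (singleton_subset_iff.2 (hD ha')))
      omega
    · have h2 := tr (D \ {a, a'}) (sdiff_subset.trans hD)
      omega

/-- The minors' per-point inequality under `Quad2Del` on `14` points of rank `8`. -/
theorem inOutMinors_of_quad2del (hn : (gr N).card = 14) (hq : Quad2Del N) :
    InOutMinors N := by
  intro x w e hxg hwg hxw hx1 he hn₀ hR₀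
  have hgr : gr ((N ／ ({x} : Set α)) ＼ ({w} : Set α)) = ((gr N).erase x).erase w := by
    rw [gr_delete', gr_contract']
  have hcard : (gr ((N ／ ({x} : Set α)) ＼ ({w} : Set α))).card = 12 := by
    rw [hgr, card_erase_of_mem (mem_erase.2 ⟨hxw.symm, hwg⟩), card_erase_of_mem hxg, hn]
  exact inCount_five_le_outCount_six_of_twelve_of_quad2 hcard (by omega) (quad2_minor hq hxg hwg hxw hx1) he

/-- The minors' per-pair inequality on `14` points of rank `8`: the §64 theorem at `n = 12`. -/
theorem inOutPairMinors_of_fourteen (hn : (gr N).card = 14) : InOutPairMinors N := by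
  intro x w S hxg hwg hxw _ hS hS2 hn₀ hR₀
  have hgr : gr ((N ／ ({x} : Set α)) ＼ ({w} : Set α)) = ((gr N).erase x).erase w := by
    rw [gr_delete', gr_contract']
  have hcard : (gr ((N ／ ({x} : Set α)) ＼ ({w} : Set α))).card = 12 := by
    rw [hgr, card_erase_of_mem (mem_erase.2 ⟨hxw.symm, hwg⟩), card_erase_of_mem hxg, hn]
  exact thruCount_five_le_thruCount_six_of_card_eq_twelve hcard (by omega) hS hS2

/-- **THEOREM A'S STEP AT THE LEVEL `6` ON `14` POINTS OF RANK `8` UNDER `Quad2Del`**: `8·P_6 ≤ 7·P_7`. -/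
theorem biIndep_step_six_of_fourteen_of_quad2del (hn : (gr N).card = 14) (hR : rk N (gr N) = 8)
    (hq : Quad2Del N) : 8 * (biIndepSets N 6).card ≤ 7 * (biIndepSets N 7).card := by
  have h := biIndep_step_six_of_nullity_six_of_minors (inOutMinors_of_quad2del hn hq)
    (inOutPairMinors_of_fourteen hn) (by omega) (by omega)
  rw [hn] at h
  exact h

/-- **THE q = 7 ROW AT `n = 14` UNDER `Quad2Del`**: the co-rank-7 top threshold `(I_7)` on every matroid with `14`
points and rank `8` every deletion of which satisfies the second quad hypothesis. -/
theorem thresholdIneq_seven_top_of_fourteen_of_quad2del (hn : (gr N).card = 14) (hR : rk N (gr N) = 8)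
    (hq : Quad2Del N) : ThresholdIneq N 7 7 := by
  have h := thresholdIneq_seven_top_of_nullity_le_six_of_minors (inOutMinors_of_quad2del hn hq)
    (inOutPairMinors_of_fourteen hn) (by omega) (by omega)
  rw [hR] at h
  exact h

end FourteenQuad2

end PercRepro.Cogirth
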